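import Summits.ResolutionOfSingularities.ResolutionOfSingularities.Theorems.StalkThread1

/-!
# StalkThread2 — the KERNEL-ZERO stalk chain along a forced tower (Layer A of the tower dictionary), slice 2/2: §3–§4

* §3 `IStage` (an injective stalk map + principality of the marked stalk ideal), `inextStage`, `inextCert`, `ichain` and the
  accessor lemmas `inextStage_comp`, `inextStage_dominates`, `inextStage_fact` (certificate + factorization between
  consecutive stages), `exists_generator_ichain`.
* §4 `exists_iStage_zero` — stage `0` from `Rooted`: `𝒪_{X_0,x_0} = k[u][Z]_𝔮 ↪ L`, `a/s ↦ χ a / χ s`, for any injective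
  `χ : k[u][Z] ↪ L`; `𝔮 ∋ Z^q + F` maximal, `ψ₀ f₀ = χ(Z^q + F)`, image `= {χ a / χ s : s ∉ 𝔮}`.

(Slice 2/2 of the farm-checked monolith `StalkThread.lean` (decomp-res lens-5 g39); slice 1 = `StalkThread1.lean`.)
All PROVED, 0 sorry.  Sources: [HerrmannIkedaOrbanz1988, Thm. (30.2) (proof)], [Kollar2007, §1.4, 3.58–3.60],
[CossartPiltant2019, §2.2, Def. 2.3], [Hauser2010, §F], [StacksProject, Tag 0804, 07Z3].
-/

noncomputable section

set_option linter.dupNamespace false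

open IsLocalRing IsLocalization
open Literature.AlgebraicGeometry.Resolution

namespace Summit.ResolutionOfSingularities.ResolutionOfSingularities.Theorems.StalkThread

open Summit.ResolutionOfSingularities.ResolutionOfSingularities.Theorems.ShallowPort

/-! ## §3 The kernel-zero chain -/

section Chain

open CategoryTheory AlgebraicGeometry TopologicalSpace Topology
open Scheme.IdealSheafData
open Summit.ResolutionOfSingularities.ResolutionOfSingularities.Theorems.ForcedTowerClasses
open Summit.ResolutionOfSingularities.ResolutionOfSingularities.Theorems.HugValuationCut

variable {k : Type} [Field k]

/-- (Type-valued carrier.) **A stage of the kernel-zero stalk chain**: an INJECTIVE ring map `ψ_i : 𝒪_{X_i,x_i} ↪ L`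
together with the principality of the marked stalk ideal `(I_i)_{x_i}`. -/
structure IStage (T : ForcedTower) (L : Type) [Field L] (i : ℕ) : Type where
  /-- the stalk embedding -/
  ψ : (T.St i).presheaf.stalk (T.pt i) →+* L
  /-- it is injective -/
  inj : Function.Injective ψ
  /-- the marked stalk ideal is principal -/
  principal : (stalkIdeal (T.D i).ideal (T.pt i)).IsPrincipal

/-- **The next stage of the kernel-zero chain** (a choice in `tower_step_inj`). -/
noncomputable def inextStage (T : ForcedTower) (g : T.St 0 ⟶ Spec (.of k)) (hB : IsBase (T.St 0) g) {q : ℕ}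
    (hD : IsDatum q (T.D 0)) (i : ℕ) {L : Type} [Field L] (S : IStage T L i) : IStage T L (i + 1) :=
  ⟨Classical.choose (tower_step_inj T g hB hD i S.ψ S.inj S.principal),
    (Classical.choose_spec (Classical.choose_spec (tower_step_inj T g hB hD i S.ψ S.inj S.principal))).1,
    (Classical.choose_spec (Classical.choose_spec (tower_step_inj T g hB hD i S.ψ S.inj S.principal))).2.2.2.1⟩

/-- **The certificate of the next stage** (the chart of the point blow-up that carries `x_{i+1}`). -/
noncomputable def inextCert (T : ForcedTower) (g : T.St 0 ⟶ Spec (.of k)) (hB : IsBase (T.St 0) g) {q : ℕ}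
    (hD : IsDatum q (T.D 0)) (i : ℕ) {L : Type} [Field L] (S : IStage T L i) :
    PointBlowupCert S.ψ.range (inextStage T g hB hD i S).ψ.range ((maximalIdeal _).map S.ψ.rangeRestrict) :=
  Classical.choose (Classical.choose_spec (tower_step_inj T g hB hD i S.ψ S.inj S.principal))

/-- `ψ_{i+1} ∘ π_i^♯ = ψ_i`. [folklore] -/
theorem inextStage_comp (T : ForcedTower) (g : T.St 0 ⟶ Spec (.of k)) (hB : IsBase (T.St 0) g) {q : ℕ}
    (hD : IsDatum q (T.D 0)) (i : ℕ) {L : Type} [Field L] (S : IStage T L i)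
    (a : (T.St i).presheaf.stalk ((T.π i).base (T.pt (i + 1)))) :
    (inextStage T g hB hD i S).ψ (((T.π i).stalkMap (T.pt (i + 1))).hom a) =
      S.ψ (((T.St i).presheaf.stalkCongr (.of_eq (T.pt_map i))).hom.hom a) :=
  (Classical.choose_spec (Classical.choose_spec (tower_step_inj T g hB hD i S.ψ S.inj S.principal))).2.1 a

/-- `B_{i+1} = ψ_{i+1}(𝒪_{x_{i+1}})` dominates `B_i`. [folklore] -/
theorem inextStage_dominates (T : ForcedTower) (g : T.St 0 ⟶ Spec (.of k)) (hB : IsBase (T.St 0) g) {q : ℕ}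
    (hD : IsDatum q (T.D 0)) (i : ℕ) {L : Type} [Field L] (S : IStage T L i) :
    SubringDominates S.ψ.range (inextStage T g hB hD i S).ψ.range :=
  (Classical.choose_spec (Classical.choose_spec (tower_step_inj T g hB hD i S.ψ S.inj S.principal))).2.2.1

/-- **The factorization between consecutive stages**: `ψ_i f_i = ψ_{i+1} w · c_j^q · ψ_{i+1} f_{i+1}`. [folklore] -/
theorem inextStage_fact (T : ForcedTower) (g : T.St 0 ⟶ Spec (.of k)) (hB : IsBase (T.St 0) g) {q : ℕ}
    (hD : IsDatum q (T.D 0)) (i : ℕ) {L : Type} [Field L] (S : IStage T L i)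
    (f : (T.St i).presheaf.stalk (T.pt i)) (hf : stalkIdeal (T.D i).ideal (T.pt i) = Ideal.span {f}) :
    ∃ f' w, IsUnit w ∧ stalkIdeal (T.D (i + 1)).ideal (T.pt (i + 1)) = Ideal.span {f'} ∧
      S.ψ f = (inextStage T g hB hD i S).ψ w *
        (((inextCert T g hB hD i S).c (inextCert T g hB hD i S).j : S.ψ.range) : L) ^ q *
        (inextStage T g hB hD i S).ψ f' :=
  (Classical.choose_spec (Classical.choose_spec (tower_step_inj T g hB hD i S.ψ S.inj S.principal))).2.2.2.2 f hf

/-- **The kernel-zero stalk chain** `ψ_0, ψ_1, …` grown from a stage-`0` embedding. -/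
noncomputable def ichain (T : ForcedTower) (g : T.St 0 ⟶ Spec (.of k)) (hB : IsBase (T.St 0) g) {q : ℕ}
    (hD : IsDatum q (T.D 0)) {L : Type} [Field L] (S₀ : IStage T L 0) : ∀ i, IStage T L i
  | 0 => S₀
  | i + 1 => inextStage T g hB hD i (ichain T g hB hD S₀ i)

/-- The chain at `i + 1` is the next stage of the chain at `i`. [folklore] -/
theorem ichain_succ (T : ForcedTower) (g : T.St 0 ⟶ Spec (.of k)) (hB : IsBase (T.St 0) g) {q : ℕ}
    (hD : IsDatum q (T.D 0)) {L : Type} [Field L] (S₀ : IStage T L 0) (i : ℕ) :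
    ichain T g hB hD S₀ (i + 1) = inextStage T g hB hD i (ichain T g hB hD S₀ i) := rfl

/-- The images `B_i = ψ_i(𝒪_{X_i,x_i})` are local rings. [folklore] -/
theorem isLocalRing_ichain_range (T : ForcedTower) (g : T.St 0 ⟶ Spec (.of k)) (hB : IsBase (T.St 0) g) {q : ℕ}
    (hD : IsDatum q (T.D 0)) {L : Type} [Field L] (S₀ : IStage T L 0) (i : ℕ) :
    IsLocalRing (ichain T g hB hD S₀ i).ψ.range :=
  isLocalRing_range _

/-- **Every stage has a generator** `f_i` of `(I_i)_{x_i}`, nonzero and in `𝔪^q`. [folklore] -/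
theorem exists_generator_ichain (T : ForcedTower) (g : T.St 0 ⟶ Spec (.of k)) (hB : IsBase (T.St 0) g) {q : ℕ}
    (hD : IsDatum q (T.D 0)) {L : Type} [Field L] (S₀ : IStage T L 0) (i : ℕ) :
    ∃ f : (T.St i).presheaf.stalk (T.pt i), stalkIdeal (T.D i).ideal (T.pt i) = Ideal.span {f} ∧ f ≠ 0 ∧
      f ∈ maximalIdeal _ ^ q :=
  exists_generator_stage T g hB hD i (ichain T g hB hD S₀ i).principal

end Chain

/-! ## §4 Stage zero of the kernel-zero chain (from `Rooted`) -/

section StageZero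

open CategoryTheory AlgebraicGeometry TopologicalSpace Topology Polynomial
open Scheme.IdealSheafData
open Summit.ResolutionOfSingularities.ResolutionOfSingularities.Theorems.ForcedTowerClasses
open Summit.ResolutionOfSingularities.ResolutionOfSingularities.Theorems.HugValuationCut
open Summit.ResolutionOfSingularities.ResolutionOfSingularities.Theorems.TightDefectClasses

variable {k : Type} [Field k]

/-- **Stage zero.**  For a forced tower ROOTED at the polynomial pure head `(Z^q + F, q)` (`X_0 ≅ 𝔸⁴_k = Spec k[u][Z]`,
`D 0 = (Z^q + F)·𝒪`) and any INJECTIVE ring map `χ : k[u][Z] ↪ L` to a field, the stalk `𝒪_{X_0,x_0} = k[u][Z]_𝔮`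
(`𝔮 ∋ Z^q + F` the maximal ideal of the closed point `x_0`) embeds into `L` by `a/s ↦ χ a / χ s`; this is a stage `0` of the
kernel-zero chain, its marked stalk ideal is generated by an `f₀` with `ψ₀ f₀ = χ(Z^q + F)`, and its image is
`{χ a / χ s : s ∉ 𝔮}`. [cite: CossartPiltant2019, Def. 2.3] [cite: Hauser2010, §F] -/
theorem exists_iStage_zero {q : ℕ} (hq : 1 ≤ q) (F : Base k) (T : ForcedTower) (hD : IsDatum q (T.D 0))
    (hroot : Rooted T k q F) {L : Type} [Field L] (χ : Polynomial (Base k) →+* L) (hχ : Function.Injective χ) :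
    ∃ (S₀ : IStage T L 0) (𝔮 : Ideal (Polynomial (Base k))), 𝔮.IsMaximal ∧ X ^ q + C F ∈ 𝔮 ∧
      (∃ f₀, stalkIdeal (T.D 0).ideal (T.pt 0) = Ideal.span {f₀} ∧ S₀.ψ f₀ = χ (X ^ q + C F)) ∧
      (∀ s, s ∉ 𝔮 → χ s ≠ 0) ∧
      (∀ x, x ∈ S₀.ψ.range ↔ ∃ a s, s ∉ 𝔮 ∧ x = χ a / χ s) := by
  classical
  obtain ⟨ι, hι⟩ := hroot
  -- (A) stage `0` is affine; the stalk at `x_0` is `Γ(X_0)_𝔮`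
  haveI : IsAffine (T.St 0) := IsAffine.of_isIso ι.inv
  have hU : IsAffineOpen (⊤ : (T.St 0).Opens) := isAffineOpen_top (T.St 0)
  letI alg := (T.St 0).presheaf.algebra_section_stalk (⟨T.pt 0, trivial⟩ : (⊤ : (T.St 0).Opens))
  haveI hlocst : IsLocalization.AtPrime ((T.St 0).presheaf.stalk (T.pt 0))
      (hU.primeIdealOf ⟨T.pt 0, trivial⟩).asIdeal := hU.isLocalization_stalk ⟨T.pt 0, trivial⟩
  have hqmax : (hU.primeIdealOf ⟨T.pt 0, trivial⟩).asIdeal.IsMaximal :=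
    hU.primeIdealOf_isMaximal_of_isClosed ⟨T.pt 0, trivial⟩ (T.isClosed_pt 0)
  generalize hy₀ : hU.primeIdealOf ⟨T.pt 0, trivial⟩ = y₀ at hlocst hqmax
  -- (B) `Γ(X_0) ≅ k[u][Z]`, `H = Z^q + F`, `D 0 = (H)·𝒪`
  let eΓ : CommRingCat.of (Polynomial (Base k)) ≅ Γ(T.St 0, ⊤) :=
    (Scheme.ΓSpecIso (CommRingCat.of (Polynomial (Base k)))).symm ≪≫ Scheme.Γ.mapIso ι.symm.op
  let eψ : Polynomial (Base k) ≃+* Γ(T.St 0, ⊤) := eΓ.commRingCatIsoToRingEquiv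
  have heψ : ∀ a, eψ a = ι.inv.appTop.hom ((Scheme.ΓSpecIso (CommRingCat.of (Polynomial (Base k)))).inv.hom a) :=
    fun a => rfl
  set h₀ : Polynomial (Base k) := X ^ q + C F with hh₀
  have hideal : (T.D 0).ideal = ofIdealTop (Ideal.span {eψ h₀}) := by
    have h1 : (T.D 0).ideal = ((T.D 0).ideal.comap ι.hom).comap ι.inv := by
      rw [← Scheme.IdealSheafData.comap_comp, Iso.inv_hom_id, Scheme.IdealSheafData.comap_id]
    have h2 : (T.D 0).ideal.comap ι.hom = pureIdeal k q F := by
      have := congrArg MarkedIdeal.ideal hι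
      rwa [MarkedIdeal.comap_ideal] at this
    rw [h1, h2, pureIdeal, comap_ofIdealTop_of_isAffine, Ideal.map_span, Set.image_singleton, heψ, ← hh₀]
  have hstalk : stalkIdeal (T.D 0).ideal (T.pt 0) =
      Ideal.span {algebraMap Γ(T.St 0, ⊤) ((T.St 0).presheaf.stalk (T.pt 0)) (eψ h₀)} := by
    rw [hideal, stalkIdeal_eq_map_germ _ ⟨⊤, hU⟩ (trivial : T.pt 0 ∈ (⊤ : (T.St 0).Opens)),
      ideal_ofIdealTop_top, Ideal.map_span, Set.image_singleton]
    rfl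
  -- (C) `H ∈ y₀.asIdeal`
  have hHq : eψ h₀ ∈ y₀.asIdeal := by
    rw [← IsLocalization.AtPrime.to_map_mem_maximal_iff ((T.St 0).presheaf.stalk (T.pt 0)) y₀.asIdeal (eψ h₀)]
    have hle := tower_stalkIdeal_le_pow T hD 0
    rw [hstalk] at hle
    exact Ideal.pow_le_self (Nat.one_le_iff_ne_zero.mp hq) ((Ideal.span_singleton_le_iff_mem _).mp hle)
  -- (D) the embedding `ψ₀ = (χ ∘ eψ⁻¹)` localised at `y₀`
  let χΓ : Γ(T.St 0, ⊤) →+* L := χ.comp eψ.symm.toRingHom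
  have hχΓ : ∀ a, χΓ (eψ a) = χ a := fun a => by
    change χ (eψ.symm (eψ a)) = χ a
    rw [eψ.symm_apply_apply]
  have hχΓinj : Function.Injective χΓ := hχ.comp eψ.symm.injective
  have hunit : ∀ s : y₀.asIdeal.primeCompl, IsUnit (χΓ s) := by
    intro s
    rw [isUnit_iff_ne_zero]
    intro hs0
    have hs : (s : Γ(T.St 0, ⊤)) = 0 := hχΓinj (by rw [hs0, map_zero])
    exact s.2 (by rw [hs]; exact y₀.asIdeal.zero_mem)
  let ψ₀ : (T.St 0).presheaf.stalk (T.pt 0) →+* L := IsLocalization.lift (M := y₀.asIdeal.primeCompl) hunit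
  have hψ₀a : ∀ s, ψ₀ (algebraMap Γ(T.St 0, ⊤) _ s) = χΓ s := fun s => IsLocalization.lift_eq hunit s
  have hψ₀inj : Function.Injective ψ₀ := by
    refine (IsLocalization.lift_injective_iff _).mpr fun x y => ⟨fun h => ?_, fun h => by rw [hχΓinj h]⟩
    obtain ⟨s, hs⟩ := IsLocalization.exists_of_eq (M := y₀.asIdeal.primeCompl) h
    have := congrArg χΓ hs
    rw [map_mul, map_mul] at this
    exact mul_left_cancel₀ (hunit s).ne_zero this
  have hψ₀mk : ∀ (b : Γ(T.St 0, ⊤)) (s : y₀.asIdeal.primeCompl),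
      ψ₀ (IsLocalization.mk' ((T.St 0).presheaf.stalk (T.pt 0)) b s) = χΓ b / χΓ s := by
    intro b s
    rw [eq_div_iff (hunit s).ne_zero, ← hψ₀a s, ← hψ₀a b, ← map_mul, IsLocalization.mk'_spec]
  have hmem𝔮 : ∀ s : Polynomial (Base k), s ∈ y₀.asIdeal.comap eψ.toRingHom ↔ eψ s ∈ y₀.asIdeal := fun s => Iff.rfl
  refine ⟨⟨ψ₀, hψ₀inj, ⟨⟨_, hstalk⟩⟩⟩, y₀.asIdeal.comap eψ.toRingHom,
    Ideal.comap_isMaximal_of_surjective eψ.toRingHom eψ.surjective, (hmem𝔮 h₀).mpr hHq,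
    ⟨_, hstalk, by rw [hψ₀a, hχΓ]⟩, fun s hs h0 => hs ((hmem𝔮 s).mpr ?_), fun x => ⟨?_, ?_⟩⟩
  · have : eψ s = 0 := hχΓinj (by rw [hχΓ, h0, map_zero])
    rw [this]; exact y₀.asIdeal.zero_mem
  · rintro ⟨z, rfl⟩
    obtain ⟨⟨b, s⟩, rfl⟩ := IsLocalization.mk'_surjective y₀.asIdeal.primeCompl z
    refine ⟨eψ.symm b, eψ.symm s, fun hs => s.2 ?_, ?_⟩
    · rw [hmem𝔮, RingEquiv.apply_symm_apply] at hs
      exact hs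
    · change ψ₀ _ = _
      rw [hψ₀mk, ← hχΓ (eψ.symm b), ← hχΓ (eψ.symm s), RingEquiv.apply_symm_apply, RingEquiv.apply_symm_apply]
  · rintro ⟨a, s, hs, rfl⟩
    have hs' : eψ s ∈ y₀.asIdeal.primeCompl := fun h => hs ((hmem𝔮 s).mpr h)
    refine ⟨IsLocalization.mk' ((T.St 0).presheaf.stalk (T.pt 0)) (eψ a) ⟨eψ s, hs'⟩, ?_⟩
    change ψ₀ _ = _
    rw [hψ₀mk, hχΓ]
    exact congrArg _ (hχΓ s)

end StageZero

end Summit.ResolutionOfSingularities.ResolutionOfSingularities.Theorems.StalkThread
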